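import Literature.AlgebraicGeometry.Resolution.BlowupSequencesExtensions
import Literature.AlgebraicGeometry.Resolution.SmoothStalkLinearPartCriterion
import Literature.AlgebraicGeometry.Resolution.SmoothOfRegularPerfectField
import Literature.AlgebraicGeometry.Resolution.DiffIdealStalk
import Literature.AlgebraicGeometry.Resolution.DiffIdealSupportOrder
import Literature.AlgebraicGeometry.Resolution.DiffIdealBlowupAlgebra
import Literature.AlgebraicGeometry.Resolution.DiffOpBlowupShiftLaw
import Literature.AlgebraicGeometry.Resolution.DiffOpBlowupStalkShift
import Literature.AlgebraicGeometry.Resolution.RegularImpliesSmooth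
import Literature.AlgebraicGeometry.Resolution.DerivativeIdealSheaf
import Literature.AlgebraicGeometry.Resolution.RegularWeakTransformPrime
import Literature.AlgebraicGeometry.Resolution.BlowupSNC
import Literature.AlgebraicGeometry.Resolution.BlowupOffCentre
import Literature.AlgebraicGeometry.Resolution.MonomialOrderReductionUnit
import Literature.AlgebraicGeometry.Resolution.HypersurfaceTransform
import Literature.AlgebraicGeometry.Resolution.ColonIdealSheafFG
import Literature.AlgebraicGeometry.Resolution.SharpOrderCoordinateCentre
import Literature.AlgebraicGeometry.Resolution.RegularSubschemeLocallyIrreducible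
import Literature.AlgebraicGeometry.Resolution.GenericPointStalkData
import Literature.AlgebraicGeometry.Resolution.RegularLocalRingsQuotient
import Literature.AlgebraicGeometry.Resolution.KollarTripleMaxOrd
import Summits.ResolutionOfSingularities.ResolutionOfSingularities.Theorems.WeakOrderReduction
import HarnessLib

/-!
# AbsoluteContactPrimitives — §2 of the decomp-res lens-6 node «AbsoluteContact / AbsoluteGiraud» (g15 rev1 @cca8a261 = g16
@bc25b587 §2 VERBATIM; CRITIC-LEDGER rows 110–112, 118 CLEARED): the two point predicates `SepResidueAt`
(separable residue field at a
point, for the tree's `stalkAlgebra`) and `IsAbsContactAt 𝓘 n y` — ABSOLUTE (`ℤ`-linear, Grothendieck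
`Diff^{≤ n−1}_ℤ`) MAXIMAL CONTACT at a
point (NEW OBJECT of lens-6) — with their PROVED kernels (restriction of scalars `isDiffOpLE_restrict` /
`diffIdeal_restrict_le`,
`k`-contact ⟹ absolute contact `isAbsContactAt_of_isContactPt`, closed points of finite type: finite / perfect ⟹
separable residue).
HOME = run/shared/lean/pub/decomp-res; source HOME/decomp-res-lens-6/g16/AbsoluteGiraud.lean.
[WRITER NOTE (decomp-res writer g6): landed FIRST and ALONE, route-independent and cone-free (imports: Literature +
`WeakOrderReduction`
only), in lens-6's namespace `…Theorems.AbsoluteContactClasses`, so that there is ONE `IsAbsContactAt` in the tree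
(critic rows 114 r1 /
118): lens-4's «FactorContact» (`FactorContactClasses`) opens it instead of restating it, and lens-6's class file
/ `AbsoluteGiraud`
kernels (§3–§8) extend this namespace when they land.]
(Sources: EGAIV4 §16.8 (differential operators over a base ring); Giraud1975; Matsumura1987 Thm. 26.5;
CossartJannsenSaito2020.)
-/

noncomputable section

open CategoryTheory AlgebraicGeometry TopologicalSpace
open Literature.AlgebraicGeometry.Resolution
open Summit.ResolutionOfSingularities.ResolutionOfSingularities.Theorems
open WeakOrderReduction

namespace Summit.ResolutionOfSingularities.ResolutionOfSingularities.Theorems.AbsoluteContactClasses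

/-! ## §2 The two new predicates: residue separability at a point, ABSOLUTE (prime-field-linear) contact at a point -/

/-- **`SepResidueAt g y`** — the residue field `κ(y)` of `𝒪_{Y,y}` is a SEPARABLE algebraic extension of the
ground field `k`, for the
tree's `k`-structure `stalkAlgebra` of the stalk (`k → Γ(Y, 𝒪_Y) → 𝒪_{Y,y} → κ(y)`).  Automatic over a
perfect field at closed points
(`sepResidueAt_of_perfectField`); fails exactly at the centres of the barrier `SmoothVsRegularImperfectBase`.
DEFINITION (support). -/
def SepResidueAt {k : Type} [Field k] {Y : Scheme.{0}} (g : Y ⟶ Spec (.of k)) (y : Y) : Prop :=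
  letI := stalkAlgebra (g.appTop.hom.comp (Scheme.ΓSpecIso (.of k)).inv.hom) y
  Algebra.IsSeparable k (IsLocalRing.ResidueField (Y.presheaf.stalk y))

/-- **`IsAbsContactAt 𝓘 n y` — ABSOLUTE CONTACT** (NEW OBJECT of this node): some element of the `Diff^{≤
n−1}`-ideal of the stalk ideal
`𝓘_y`, the differential operators being those of `𝒪_{Y,y}` over the base ring `ℤ` (Grothendieck, EGA IV
16.8, `IsDiffOpLE ℤ`; in
characteristic `p` these are the `𝔽_p`-linear operators, automatically `𝒪^q`-linear in order `< q`), lies in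
`𝔪_y ∖ 𝔪_y²`: its zero
locus is a regular hypersurface germ of (absolute) maximal contact.  No field, no structure map. DEFINITION (support). -/
def IsAbsContactAt {Y : Scheme.{0}} (I : Y.IdealSheafData) (n : ℕ) (y : Y) : Prop :=
  ∃ u ∈ diffIdeal ℤ (n - 1) (stalkIdeal I y),
    u ∈ IsLocalRing.maximalIdeal (Y.presheaf.stalk y) ∧ u ∉ IsLocalRing.maximalIdeal (Y.presheaf.stalk y) ^ 2

/-- **kernel (PROVED): restriction of scalars for Grothendieck operators** — a `k`-linear differential operator of
order `≤ n` is a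
`ℤ`-linear one of order `≤ n` (same commutators). [folklore] -/
theorem isDiffOpLE_restrict {k : Type} [Field k] {A : Type} [CommRing A] [Algebra k A] :
    ∀ (n : ℕ) (D : A →ₗ[k] A), IsDiffOpLE k n D → IsDiffOpLE ℤ n (D.toAddMonoidHom.toIntLinearMap) := by
  intro n
  induction n with
  | zero =>
      intro D hD a
      have h := hD a
      ext t
      have := LinearMap.congr_fun h t
      simpa [commMul_apply] using this
  | succ n ih =>
      intro D hD a
      have h := hD a
      have e : commMul ℤ (D.toAddMonoidHom.toIntLinearMap) a = (commMul k D a).toAddMonoidHom.toIntLinearMap := by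
        ext t; simp [commMul_apply]
      rw [e]
      exact ih _ h

/-- **kernel (PROVED)**: `Diff^{≤n}_k(J) ⊆ Diff^{≤n}_ℤ(J)`. [folklore] -/
theorem diffIdeal_restrict_le {k : Type} [Field k] {A : Type} [CommRing A] [Algebra k A] (n : ℕ) (J : Ideal A) :
    diffIdeal k n J ≤ diffIdeal ℤ n J := by
  apply Ideal.span_le.mpr
  rintro x ⟨D, hD, f, hf, rfl⟩
  exact Ideal.subset_span ⟨D.toAddMonoidHom.toIntLinearMap, isDiffOpLE_restrict n D hD, f, hf, rfl⟩

/-- **kernel (PROVED): `k`-linear contact ⟹ absolute contact** (the tree's `IsContactPt` section germ lies in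
`Diff^{≤n−1}_k(𝓘_y) = (Diff^{≤n−1}-sheaf)_y` by `stalkIdeal_diffIdealSheaf`, then restriction of
scalars). [folklore] -/
theorem isAbsContactAt_of_isContactPt {k : Type} [Field k] {Y : Scheme.{0}} (g : Y ⟶ Spec (.of k)) [LocallyOfFiniteType g]
    (I : Y.IdealSheafData) (n : ℕ) (y : Y) (h : IsContactPt g I n y) : IsAbsContactAt I n y := by
  obtain ⟨U, hyU, u, huJ, hum, hu2⟩ := h
  set φ : k →+* Γ(Y, ⊤) := g.appTop.hom.comp (Scheme.ΓSpecIso (.of k)).inv.hom with hφ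
  have hft : HasFiniteTypeSections φ := hasFiniteTypeSections_of_locallyOfFiniteType k g
  letI := stalkAlgebra φ y
  have h1 : (Y.presheaf.germ U y hyU).hom u ∈ stalkIdeal (diffIdealSheaf φ (n - 1) I) y := by
    rw [stalkIdeal_eq_map_germ (diffIdealSheaf φ (n - 1) I) U hyU]
    exact Ideal.mem_map_of_mem _ huJ
  rw [stalkIdeal_diffIdealSheaf hft] at h1
  exact ⟨_, diffIdeal_restrict_le (n - 1) _ h1, hum, hu2⟩

/-- **kernel (PROVED): the residue field at a closed point of a scheme locally of finite type over `k` is FINITE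
over `k`** for the
`k`-structure `stalkAlgebra` (Zariski's lemma; the tree's `Hironaka2017…U20p3.residueField_finite_of_isClosed`
argument with its
`IsAmbient` hypothesis weakened to `LocallyOfFiniteType`). (Sources: GortzWedhorn2020, §(5.1) (Prop. 3.33).) -/
theorem module_finite_residueField_of_isClosed {k : Type} [Field k] {Y : Scheme.{0}} (g : Y ⟶ Spec (.of k))
    [LocallyOfFiniteType g] {y : Y} (hy : IsClosed ({y} : Set Y)) :
    letI := stalkAlgebra (g.appTop.hom.comp (Scheme.ΓSpecIso (.of k)).inv.hom) y
    Module.Finite k (IsLocalRing.ResidueField (Y.presheaf.stalk y)) := by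
  set φ : k →+* Γ(Y, ⊤) := g.appTop.hom.comp (Scheme.ΓSpecIso (.of k)).inv.hom with hφ
  letI := stalkAlgebra φ y
  obtain ⟨U, hU, hyU, -⟩ :=
    exists_isAffineOpen_mem_and_subset (X := Y) (x := y) (U := ⊤) (Opens.mem_top y)
  -- `Γ(Y, U)` is of finite type over `k`
  have hft : RingHom.FiniteType (g.appLE ⊤ U le_top).hom :=
    HasRingHomProperty.appLE @LocallyOfFiniteType g inferInstance ⟨⊤, isAffineOpen_top _⟩ ⟨U, hU⟩ le_top
  have hψ : (sectionsHom φ U).FiniteType := by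
    have e : sectionsHom φ U = (g.appLE ⊤ U le_top).hom.comp (Scheme.ΓSpecIso (.of k)).inv.hom := rfl
    rw [e]
    exact hft.comp (RingHom.FiniteType.of_surjective _
      (Scheme.ΓSpecIso (.of k)).symm.commRingCatIsoToRingEquiv.surjective)
  -- the closed point `y` is a maximal ideal `𝔪` of `Γ(Y, U)` and `O_y = Γ(Y, U)_𝔪`
  set 𝔪 := (hU.primeIdealOf ⟨y, hyU⟩).asIdeal with h𝔪def
  haveI h𝔪 : 𝔪.IsMaximal := hU.primeIdealOf_isMaximal_of_isClosed ⟨y, hyU⟩ hy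
  letI : Algebra Γ(Y, U) (Y.presheaf.stalk y) := TopCat.Presheaf.algebra_section_stalk Y.presheaf ⟨y, hyU⟩
  haveI : IsLocalization.AtPrime (Y.presheaf.stalk y) 𝔪 := hU.isLocalization_stalk ⟨y, hyU⟩
  have hunder : ((IsLocalRing.maximalIdeal (Y.presheaf.stalk y)).under Γ(Y, U)).IsMaximal := by
    rw [IsLocalization.AtPrime.under_maximalIdeal (Y.presheaf.stalk y) 𝔪]
    exact h𝔪
  have hq := IsLocalization.surjective_quotientMap_of_maximal_of_localization 𝔪.primeCompl (Y.presheaf.stalk y)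
    (I := IsLocalRing.maximalIdeal (Y.presheaf.stalk y)) (J := (⊥ : Ideal Γ(Y, U))) (H := bot_le) hunder
  have hsurj : Function.Surjective
      ((IsLocalRing.residue (Y.presheaf.stalk y)).comp (Y.presheaf.germ U y hyU).hom) := by
    intro t
    obtain ⟨a, ha⟩ := hq t
    obtain ⟨a, rfl⟩ := Ideal.Quotient.mk_surjective a
    rw [Ideal.quotientMap_mk] at ha
    exact ⟨a, ha⟩
  -- hence `κ(y)` is of finite type over `k`, and a field: Zariski's lemma
  have hcomp : algebraMap k (IsLocalRing.ResidueField (Y.presheaf.stalk y)) =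
      ((IsLocalRing.residue (Y.presheaf.stalk y)).comp (Y.presheaf.germ U y hyU).hom).comp (sectionsHom φ U) := by
    rw [RingHom.comp_assoc, germ_comp_sectionsHom]
    rfl
  have hFT : (algebraMap k (IsLocalRing.ResidueField (Y.presheaf.stalk y))).FiniteType := by
    rw [hcomp]
    exact (RingHom.FiniteType.of_surjective _ hsurj).comp hψ
  haveI : Algebra.FiniteType k (IsLocalRing.ResidueField (Y.presheaf.stalk y)) := RingHom.finiteType_algebraMap.mp hFT
  exact finite_of_finite_type_of_isJacobsonRing k _

/-- **kernel (PROVED)**: over a PERFECT field every closed point of a base has separable residue field — the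
perfect slice sits inside
the separable-residue slice. [folklore] -/
theorem sepResidueAt_of_perfectField {k : Type} [Field k] [PerfectField k] {Y : Scheme.{0}} (g : Y ⟶ Spec (.of k))
    [LocallyOfFiniteType g] {y : Y} (hy : IsClosed ({y} : Set Y)) : SepResidueAt g y := by
  letI := stalkAlgebra (g.appTop.hom.comp (Scheme.ΓSpecIso (.of k)).inv.hom) y
  haveI : Module.Finite k (IsLocalRing.ResidueField (Y.presheaf.stalk y)) := module_finite_residueField_of_isClosed g hy
  haveI : Algebra.IsAlgebraic k (IsLocalRing.ResidueField (Y.presheaf.stalk y)) := Algebra.IsAlgebraic.of_finite k _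
  show Algebra.IsSeparable k (IsLocalRing.ResidueField (Y.presheaf.stalk y))
  infer_instance

/-- **kernel (PROVED)**: an inseparable residue field at a closed point forces the ground field to be imperfect. [folklore] -/
theorem not_perfectField_of_not_sepResidueAt {k : Type} [Field k] {Y : Scheme.{0}} (g : Y ⟶ Spec (.of k))
    [LocallyOfFiniteType g] {y : Y} (hy : IsClosed ({y} : Set Y)) (h : ¬ SepResidueAt g y) : ¬ PerfectField k :=
  fun hk => by haveI := hk; exact h (sepResidueAt_of_perfectField g hy)

end Summit.ResolutionOfSingularities.ResolutionOfSingularities.Theorems.AbsoluteContactClasses
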